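import Summits.Parity.GeneralizedHardyLittlewood.Theorems.GreenTaoLevelTwoMNTwoSectionEightCore
import Summits.Parity.GeneralizedHardyLittlewood.Theorems.GreenTaoLevelTwoMNTwoTorusPartition
import Summits.Parity.GeneralizedHardyLittlewood.Theorems.GreenTaoLevelTwoMNTwoDyadicToFull

/-!
# Route `GreenTaoLevelTwo`, crux `MNTwo` (stmt-Parity-21276), line `birth`, stub `stub_mnVertical`:
# GT 2008b §8 assembled, I — the core estimate instantiated and the bookkeeping of constants

Block V3 of the `stub_mnVertical` census (B. Green, T. Tao, *Quadratic uniformity of the Möbius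
function*, Ann. Inst. Fourier 58 (2008) = arXiv:math/0606087, §8): the deduction of Theorem 4
("`μ` is strongly orthogonal to local quadratics": for a `1`-step nilsequence `F(T_gⁿ x)` and a
phase `φ` locally quadratic on `B_N = {n : F(T_gⁿx) ≠ 0}`,
`𝔼_n μ(n) F(T_gⁿ x) e(−φ(n)) ≪_{G/Γ,A} ‖F‖_Lip log^{-A} N`) from Proposition 19 ("`μ` is strongly
orthogonal to extendible local quadratics"), for the `1`-step nilmanifold realised as the torus
`ℝᵏ/ℤᵏ` with rotation `α` (the form block V1 `…MNTwoMoebiusLipschitzTorus` uses: `F : ℝᵏ → ℝ`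
`ℤᵏ`-periodic, `1`-bounded, `M`-Lipschitz for the sup-distance; orbit `x + nα`).

The HYPOTHESIS `hP` is Proposition 19 in printed form, for every saving `A` (the constant may
depend on `A` and `k`): Bohr balls `B_α(n₀,ρ) = {n ∈ ℤ : ‖(n−n₀)αᵢ‖_{ℝ/ℤ} + |n−n₀|/N < ρ ∀ i}`
(with the extra clause `|n−n₀|/N < ρ`, as in `…MNTwoRotationBohrSize`), `0 < ρ < 10⁻⁵`,
`B_α(n₀,100ρ) ⊆ (N,2N]`, `φ : ℤ → ℝ` locally quadratic on `B_α(n₀,100ρ)` (every `3`-cube with all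
`8` vertices in the ball has integral alternating sum), `ψ : ℤ → ℝ≥0` supported on `B_α(n₀,ρ)` with
`|ψ(n) − ψ(n')| ≤ ‖n − n'‖_α := supᵢ‖(n−n')αᵢ‖_{ℝ/ℤ} + |n−n'|/N` (spelled with an auxiliary
`t ≥ supᵢ`), conclusion `‖∑_{N<n≤2N} μ(n)ψ(n)e(−φ(n))‖ ≤ C N/log^A N`.  Blocks V4–V6 of the
census (§§9–12 of the source) are to prove exactly this hypothesis.

Proof (source, §8): `torusLipschitz_of_periodic` (periodicity + sup-Lipschitz ⇒ torus-Lipschitz),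
`…SectionEightCore.sectionEight_core` with the explicit partition of unity of
`…MNTwoTorusPartition` (`m = ⌈8/ρ₀⌉` tents per coordinate), `ρ₀ = 10⁻⁶ log^{-A} N`, Proposition 19
at saving `A(k+3)`; then `…MNTwoDyadicToFull` for the initial segment.  Def-free:

* `periodic_single_int`, `torusLipschitz_of_periodic`; `core_instance` (the core estimate with the
  explicit partition), `constants_bookkeeping` (the choice `ρ₀ = 10⁻⁶/log^A N`).
The companion file `…MNTwoSectionEight` concludes Theorem 4 on `(N, 2N]` and on `[1, N]`.

References: [GreenTao2008QuadraticMobius] arXiv:math/0606087, Thm. 4, Prop. 19, §8.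
-/

noncomputable section

open Finset Real ArithmeticFunction
open scoped FourierTransform ArithmeticFunction.Moebius

namespace Summit.Parity.GeneralizedHardyLittlewood.GreenTaoLevelTwoMNTwoSectionEightInstance

open Summit.Parity.GeneralizedHardyLittlewood.GreenTaoLevelTwoMNTwoSectionEightCore
open Summit.Parity.GeneralizedHardyLittlewood.GreenTaoLevelTwoMNTwoTorusPartition
open Summit.Parity.GeneralizedHardyLittlewood.GreenTaoLevelTwoMNTwoDyadicToFull

/-! ### §1 Periodic + sup-Lipschitz ⇒ torus-Lipschitz -/

/-- A `ℤᵏ`-periodic function is invariant under integer shifts in one coordinate. [folklore] -/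
theorem periodic_single_int {k : ℕ} {F : (Fin k → ℝ) → ℝ}
    (hper : ∀ y (i : Fin k), F (y + Pi.single i 1) = F y) (y : Fin k → ℝ) (i : Fin k) (z : ℤ) :
    F (y + Pi.single i (z : ℝ)) = F y := by
  have hnat : ∀ (w : Fin k → ℝ) (n : ℕ), F (w + Pi.single i (n : ℝ)) = F w := by
    intro w n
    induction n with
    | zero => simp
    | succ n ih =>
      rw [show (((n + 1 : ℕ) : ℝ)) = (n : ℝ) + 1 by push_cast; ring, Pi.single_add, ← add_assoc,
        hper, ih]
  obtain ⟨n, hn | hn⟩ := Int.eq_nat_or_neg z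
  · rw [hn]; exact_mod_cast hnat y n
  · have h := hnat (y + Pi.single i (z : ℝ)) n
    rw [add_assoc, ← Pi.single_add, hn] at h
    push_cast at h
    rw [neg_add_cancel, Pi.single_zero, add_zero] at h
    rw [hn]
    push_cast
    exact h.symm

/-- **Periodic + sup-Lipschitz ⇒ torus-Lipschitz**: if `F` is `ℤᵏ`-periodic and
`|F y − F y'| ≤ M dist(y, y')` (sup-distance on `ℝᵏ`), then `|F y − F y'| ≤ M t` whenever
`‖yᵢ − y'ᵢ‖_{ℝ/ℤ} ≤ t` for all `i`. [folklore] -/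
theorem torusLipschitz_of_periodic {k : ℕ} {F : (Fin k → ℝ) → ℝ} {M : ℝ} (hM : 0 ≤ M)
    (hper : ∀ y (i : Fin k), F (y + Pi.single i 1) = F y)
    (hlip : ∀ y y', |F y - F y'| ≤ M * dist y y') (y y' : Fin k → ℝ) (t : ℝ) (ht : 0 ≤ t)
    (hyy : ∀ i, ‖((y i - y' i : ℝ) : AddCircle (1 : ℝ))‖ ≤ t) : |F y - F y'| ≤ M * t := by
  classical
  -- shift `y'` by the integer vector of nearest integers to `y - y'`
  set z : Fin k → ℤ := fun i => round (y i - y' i) with hz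
  have hshift : ∀ s : Finset (Fin k), F (y' + ∑ i ∈ s, Pi.single i ((z i : ℤ) : ℝ)) = F y' := by
    intro s
    refine Finset.induction_on s (by simp) ?_
    intro b s hb ih
    rw [sum_insert hb, add_comm (Pi.single b _) _, ← add_assoc, periodic_single_int hper, ih]
  set y'' : Fin k → ℝ := y' + ∑ i, Pi.single i ((z i : ℤ) : ℝ) with hy''
  have hF : F y'' = F y' := hshift univ
  have hcoord : ∀ j, y'' j = y' j + (z j : ℝ) := by
    intro j
    simp only [hy'', Pi.add_apply, Finset.sum_apply, Finset.sum_pi_single, mem_univ, if_true]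
  have hdist : dist y y'' ≤ t := by
    rw [dist_pi_le_iff ht]
    intro j
    rw [Real.dist_eq, hcoord, show y j - (y' j + (z j : ℝ)) = (y j - y' j) - round (y j - y' j) by
      simp [hz]; ring]
    have := hyy j
    rw [AddCircle.norm_eq] at this
    simpa using this
  rw [← hF]
  exact (hlip y y'').trans (mul_le_mul_of_nonneg_left hdist hM)

/-! ### §2 Theorem 4 from Proposition 19 -/

/-- The core estimate instantiated with the explicit partition of unity of `…MNTwoTorusPartition`
(`m ≥ 2` tents per coordinate, `2/m ≤ ρ₀/4`) for a `ℤᵏ`-periodic sup-`M`-Lipschitz `F`.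
[cite: GreenTao2008QuadraticMobius, §8] -/
theorem core_instance (k : ℕ) {N : ℕ} (hN : 1 ≤ N) {M ρ₀ C A : ℝ}
    (hM : 0 ≤ M) (hρ₀ : 0 < ρ₀) (hρ₀' : 100000 * ρ₀ < 1) (hC : 0 ≤ C) {m : ℕ} (hm2 : 2 ≤ m)
    (h2m : 2 / (m : ℝ) ≤ ρ₀ / 4)
    (α x : Fin k → ℝ) (F : (Fin k → ℝ) → ℝ) (hFper : ∀ y (i : Fin k), F (y + Pi.single i 1) = F y)
    (hF1 : ∀ y, |F y| ≤ 1) (hFlip : ∀ y y', |F y - F y'| ≤ M * dist y y')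
    (φ : ℤ → ℝ)
    (hφ : ∀ n h₁ h₂ h₃ : ℤ,
      (∀ e₁ e₂ e₃ : ℕ, e₁ ≤ 1 → e₂ ≤ 1 → e₃ ≤ 1 →
        (N : ℤ) < n + e₁ * h₁ + e₂ * h₂ + e₃ * h₃ ∧ n + e₁ * h₁ + e₂ * h₂ + e₃ * h₃ ≤ 2 * N ∧
          F (x + ((n + e₁ * h₁ + e₂ * h₂ + e₃ * h₃ : ℤ) : ℝ) • α) ≠ 0) →
      ∃ z : ℤ, φ (n + h₁ + h₂ + h₃) - φ (n + h₁ + h₂) - φ (n + h₁ + h₃) - φ (n + h₂ + h₃)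
        + φ (n + h₁) + φ (n + h₂) + φ (n + h₃) - φ n = z)
    (hP : ∀ (n₀ : ℤ) (ρ : ℝ), 0 < ρ → 100000 * ρ < 1 →
      (∀ n : ℤ, ((∀ i, ‖((((n - n₀ : ℤ) : ℝ) * α i : ℝ) : AddCircle (1 : ℝ))‖ +
          |((n - n₀ : ℤ) : ℝ)| / N < 100 * ρ) ∧ |((n - n₀ : ℤ) : ℝ)| / N < 100 * ρ) →
        (N : ℤ) < n ∧ n ≤ 2 * N) →
      ∀ φ : ℤ → ℝ,
        (∀ n h₁ h₂ h₃ : ℤ,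
          (∀ e₁ e₂ e₃ : ℕ, e₁ ≤ 1 → e₂ ≤ 1 → e₃ ≤ 1 →
            (∀ i, ‖((((n + e₁ * h₁ + e₂ * h₂ + e₃ * h₃ - n₀ : ℤ) : ℝ) * α i : ℝ) :
                AddCircle (1 : ℝ))‖ +
              |((n + e₁ * h₁ + e₂ * h₂ + e₃ * h₃ - n₀ : ℤ) : ℝ)| / N < 100 * ρ) ∧
            |((n + e₁ * h₁ + e₂ * h₂ + e₃ * h₃ - n₀ : ℤ) : ℝ)| / N < 100 * ρ) →
          ∃ z : ℤ, φ (n + h₁ + h₂ + h₃) - φ (n + h₁ + h₂) - φ (n + h₁ + h₃) - φ (n + h₂ + h₃)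
            + φ (n + h₁) + φ (n + h₂) + φ (n + h₃) - φ n = z) →
        ∀ ψ : ℤ → ℝ, (∀ n, 0 ≤ ψ n) →
          (∀ n, ψ n ≠ 0 →
            (∀ i, ‖((((n - n₀ : ℤ) : ℝ) * α i : ℝ) : AddCircle (1 : ℝ))‖ +
                |((n - n₀ : ℤ) : ℝ)| / N < ρ) ∧ |((n - n₀ : ℤ) : ℝ)| / N < ρ) →
          (∀ (n n' : ℤ) (t : ℝ), 0 ≤ t →
            (∀ i, ‖((((n - n' : ℤ) : ℝ) * α i : ℝ) : AddCircle (1 : ℝ))‖ ≤ t) →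
              |ψ n - ψ n'| ≤ t + |((n - n' : ℤ) : ℝ)| / N) →
          ‖∑ n ∈ Ioc N (2 * N), ((μ n : ℝ) : ℂ) * ((ψ n : ℝ) : ℂ) * (𝐞 (-(φ n)) : ℂ)‖ ≤
            C * N / Real.log N ^ A) :
    ‖∑ n ∈ Ioc N (2 * N), ((μ n : ℝ) : ℂ) * (F (x + (n : ℝ) • α) : ℂ) * (𝐞 (-(φ n)) : ℂ)‖ ≤
      100 * ρ₀ * M * N + (201 * ρ₀ * N + 1) +
        (8 / ρ₀ + 1) * (m : ℝ) ^ k * (2 * (M + k * m + 16 / ρ₀) * (C * N / Real.log N ^ A)) := by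
  classical
  have hm0 : 0 < m := by omega
  have hFtor := torusLipschitz_of_periodic hM hFper hFlip
  have hcore := sectionEight_core k hN hM (by positivity : (0 : ℝ) ≤ k * m) hρ₀ hρ₀' hC α x F
    hF1 hFtor φ hφ
    (fun (a : Fin k → Fin m) (y : Fin k → ℝ) =>
      ∏ i, max 0 (1 - (m : ℝ) * ‖((y i - ((a i : ℕ) : ℝ) / m : ℝ) : AddCircle (1 : ℝ))‖))
    (fun y => sum_prodTent_eq_one hm2 k y) (fun a y => abs_prodTent_le_one k a y)
    (fun a y y' t ht hyy => abs_prodTent_sub_prodTent_le k a y y' t ht hyy)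
    (fun a y y' hy hy' i => (prodTent_support hm0 k a hy hy' i).trans_le h2m) hP
  have hcard : (Fintype.card (Fin k → Fin m) : ℝ) = (m : ℝ) ^ k := by
    rw [Fintype.card_fun, Fintype.card_fin, Fintype.card_fin]; push_cast; ring
  rw [hcard] at hcore
  exact hcore

/-- The bookkeeping of constants in §8: with `ρ₀ = 10⁻⁶/L`, `m ≤ 9/ρ₀`, `L ≥ 1`,
`L ≤ (2A)^A N` and `log^{A(k+3)} N = L^{k+2}·L`, the bound of `core_instance` (at saving
`A(k+3)`) is `≤ (2 + (2A)^A + 2·9^{k+1}(9k+17)10^{6(k+2)} C) M N / L`. [folklore] -/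
theorem constants_bookkeeping {k : ℕ} {A C M S L ρ₀ Nr : ℝ} {m : ℕ} (hC : 0 ≤ C) (hM : 1 ≤ M)
    (hN : 1 ≤ Nr) (hL1 : 1 ≤ L) (hA : 0 ≤ (2 * A) ^ A) (hLN : L ≤ (2 * A) ^ A * Nr)
    (hρ₀ : ρ₀ = 1 / (10 ^ 6 * L)) (hm9 : (m : ℝ) ≤ 9 * (1 / ρ₀))
    (hS : S ≤ 100 * ρ₀ * M * Nr + (201 * ρ₀ * Nr + 1) +
      (8 / ρ₀ + 1) * (m : ℝ) ^ k * (2 * (M + k * m + 16 / ρ₀) * (C * Nr / (L ^ (k + 2) * L)))) :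
    S ≤ (2 + (2 * A) ^ A + 2 * 9 ^ (k + 1) * (9 * k + 17) * (10 : ℝ) ^ (6 * (k + 2)) * C) *
      M * Nr / L := by
  have hLpos : 0 < L := by linarith
  have hρ₀pos : 0 < ρ₀ := by rw [hρ₀]; positivity
  have hR : 1 / ρ₀ = 10 ^ 6 * L := by rw [hρ₀, one_div_one_div]
  have hR1 : 1 ≤ 1 / ρ₀ := by rw [hR]; nlinarith
  set Q : ℝ := M * Nr / L with hQ
  have hQ0 : 0 ≤ Q := by positivity
  have hNL : Nr / L ≤ Q := by
    rw [hQ]; apply div_le_div_of_nonneg_right _ hLpos.le; nlinarith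
  have hT1 : 100 * ρ₀ * M * Nr ≤ Q := by
    have h1 : 100 * ρ₀ * M * Nr = (1 / 10000) * Q := by rw [hQ, hρ₀]; field_simp; ring
    rw [h1]
    have h3 : (1 / 10000 : ℝ) * Q ≤ 1 * Q := mul_le_mul_of_nonneg_right (by norm_num) hQ0
    linarith
  have hT2 : 201 * ρ₀ * Nr ≤ Q := by
    have h1 : 201 * ρ₀ * Nr = (201 / 10 ^ 6) * (Nr / L) := by rw [hρ₀]; field_simp
    rw [h1]
    have h2 : 0 ≤ Nr / L := by positivity
    have h3 : (201 / 10 ^ 6 : ℝ) * (Nr / L) ≤ 1 * (Nr / L) :=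
      mul_le_mul_of_nonneg_right (by norm_num) h2
    linarith
  have hT2' : (1 : ℝ) ≤ (2 * A) ^ A * Q := by
    have h3 : L ≤ (2 * A) ^ A * (M * Nr) := by
      calc L ≤ (2 * A) ^ A * Nr := hLN
        _ = (2 * A) ^ A * (1 * Nr) := by ring
        _ ≤ (2 * A) ^ A * (M * Nr) := by gcongr
    rw [hQ, ← mul_div_assoc, one_le_div hLpos]; linarith
  have hsumLip : M + (k * m : ℝ) + 16 / ρ₀ ≤ (9 * k + 17) * M * (1 / ρ₀) := by
    have h1 : (k : ℝ) * m ≤ 9 * k * M * (1 / ρ₀) := by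
      calc (k : ℝ) * m ≤ k * (9 * (1 / ρ₀)) := mul_le_mul_of_nonneg_left hm9 (Nat.cast_nonneg k)
        _ = 9 * k * 1 * (1 / ρ₀) := by ring
        _ ≤ 9 * k * M * (1 / ρ₀) := by gcongr
    have h2 : 16 / ρ₀ ≤ 16 * M * (1 / ρ₀) := by
      rw [show 16 / ρ₀ = 16 * 1 * (1 / ρ₀) by ring]; gcongr
    have h3 : M ≤ M * (1 / ρ₀) := by nlinarith
    nlinarith
  have hstep : (8 / ρ₀ + 1) * (m : ℝ) ^ k *
      (2 * (M + k * m + 16 / ρ₀) * (C * Nr / (L ^ (k + 2) * L))) ≤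
      (9 * (1 / ρ₀)) * (9 * (1 / ρ₀)) ^ k *
      (2 * ((9 * k + 17) * M * (1 / ρ₀)) * (C * Nr / (L ^ (k + 2) * L))) := by
    have h81 : 8 / ρ₀ + 1 ≤ 9 * (1 / ρ₀) := by
      rw [show 8 / ρ₀ = 8 * (1 / ρ₀) by ring]; linarith
    have hCN : 0 ≤ C * Nr / (L ^ (k + 2) * L) := by positivity
    gcongr
  have hmain : (9 * (1 / ρ₀)) * (9 * (1 / ρ₀)) ^ k *
      (2 * ((9 * k + 17) * M * (1 / ρ₀)) * (C * Nr / (L ^ (k + 2) * L))) =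
      2 * 9 ^ (k + 1) * (9 * k + 17) * (10 : ℝ) ^ (6 * (k + 2)) * C * Q := by
    rw [mul_pow, hR, mul_pow, hQ, pow_mul]
    field_simp
    ring
  have hfin : S ≤ Q + (Q + (2 * A) ^ A * Q) +
      2 * 9 ^ (k + 1) * (9 * k + 17) * (10 : ℝ) ^ (6 * (k + 2)) * C * Q := by
    linarith [hstep.trans hmain.le]
  refine hfin.trans (le_of_eq ?_)
  rw [hQ]; ring

end Summit.Parity.GeneralizedHardyLittlewood.GreenTaoLevelTwoMNTwoSectionEightInstance
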